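import Mathlib.Data.Int.Interval
import Mathlib.Data.Nat.Log
import Mathlib.Tactic.IntervalCases
import Literature.NumberTheory.ConnesConsani2023.RiemannRochSpecZ
import HarnessLib

/-!
# Connes–Consani, Riemann–Roch for the ring `ℤ` (2024) — `dim_𝕊 H⁰`: Lemma 3.2 and the core of Theorem 3.3

A. Connes, C. Consani, *Riemann–Roch for the ring `ℤ`*, C. R. Math. 362 (2024) 229–235 = arXiv:2306.00456
[bib: `ConnesConsani2024RiemannRochZ`], §3 (p. 4): over the absolute base `𝕊` the module `(Hℤ)_I`, `I = [-a, a]`, is generated by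
`G ⊆ I` when every `j ∈ I` is a subset sum `Σ_Z i` (`Z ⊆ G`) all of whose partial sums `Σ_{Z'} i`, `Z' ⊆ Z`,
lie in `I` (Lemma 3.1; typed as `SGenerates`/`sDim` in `RiemannRochSpecZ.lean`), and
`dim_𝕊 (Hℤ)_{[-a,a]} = n + 1` for `2^{n-1} ≤ a < 2^n` (Lemma 3.2 (ii); Theorem 3.3 is this with `a = ⌊e^{deg D}⌋`).

We FOLLOW THE PRINTED PROOF:
* lower bound (Lemma 3.1): `2^{#G} ≥ #I = 2a + 1` (`two_mul_add_one_le_two_pow_card`);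
* upper bound, `n > 4` (Lemma 3.2 (i)): `n` distinct positive integers with sum `a` whose subset sums cover
  `[0, a]`, by adjoining one or two elements to `T = {2^j : j ≤ n-2}` in the three printed cases
  (`cover_case1/2/3`, `exists_cover_nat`; the covering propagates by the interval trick
  `subsetSumsCover_insert`), and then `F = {-a} ∪ {α_j}` generates (`sAdm_of_cover`: "the sum of its positive
  elements is `a` and the sum of its negative elements is `-a`");
* upper bound, `n ≤ 4` (`1 ≤ a ≤ 15`): the fourteen printed sets and `{-2, 1, 2}` (`sAdm_table`), checked by
  `decide` on the integer-level predicate `SAdm`, which is transferred to `SGenerates (HZball a) a` by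
  `sGenerates_of_sAdm`.
Result: `sDim_HZ_eq` (`a ≥ 1`) and `sDim_HZ_zero` (`a = 0`).

Cell `pub-rhdoor`, seat cc-2; used by `RiemannRochRingZTheorem.lean` (Thm. 5.1).
-/

noncomputable section

open Finset

namespace Literature.NumberTheory.ConnesConsani2023

/-! ## `sInf` API for `sDim` -/

/-- A generating set bounds `dim_𝕊 (HL)_X` from above. [folklore] -/
theorem sDim_le_card {E : Set ℝ} {lam : ℝ} {G : Finset ℝ} (h : SGenerates E lam G) :
    sDim E lam ≤ G.card :=
  Nat.sInf_le ⟨G, rfl, h⟩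

/-- If some generating set exists and every generating set has `≥ k` elements then `dim_𝕊 ≥ k`. [folklore] -/
theorem le_sDim {E : Set ℝ} {lam : ℝ} {k : ℕ} (hne : ∃ G : Finset ℝ, SGenerates E lam G)
    (h : ∀ G : Finset ℝ, SGenerates E lam G → k ≤ G.card) : k ≤ sDim E lam := by
  obtain ⟨G, hG⟩ := hne
  have hmem : sDim E lam ∈ {k : ℕ | ∃ G : Finset ℝ, G.card = k ∧ SGenerates E lam G} :=
    Nat.sInf_mem ⟨G.card, G, rfl, hG⟩
  obtain ⟨G₀, hG₀, hgen⟩ := hmem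
  rw [← hG₀]
  exact h G₀ hgen

/-! ## Integer-level admissible generation (2024 Lemma 3.1) and transfer to `SGenerates` -/

/-- Integer-level form of the generation condition of 2024 Lemma 3.1 for `I = [-a, a]`: `G ⊆ I` and every
`x ∈ I` is a subset sum `Σ_Z i`, `Z ⊆ G`, with `Σ_{Z'} i ∈ I` for every `Z' ⊆ Z` — a DECIDABLE predicate on
`Finset ℤ` (used to check the table of p. 4 by `decide`). [cite: ConnesConsani2024RiemannRochZ, Lemma 3.1 p. 4] -/
def SAdm (G : Finset ℤ) (a : ℕ) : Prop :=
  (∀ g ∈ G, |g| ≤ a) ∧ ∀ x ∈ Finset.Icc (-(a : ℤ)) a,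
    ∃ Z ∈ G.powerset, ∑ i ∈ Z, i = x ∧ ∀ Z' ∈ Z.powerset, |∑ i ∈ Z', i| ≤ a

/-- `SAdm` is decidable (finite quantifiers). [folklore] -/
instance SAdm.decidable (G : Finset ℤ) (a : ℕ) : Decidable (SAdm G a) := by
  unfold SAdm; infer_instance

/-- Casting a finite set of integers into `ℝ` preserves the cardinality. [folklore] -/
theorem card_image_intCast (G : Finset ℤ) : (G.image (Int.cast : ℤ → ℝ)).card = G.card :=
  Finset.card_image_of_injective _ Int.cast_injective

/-- Casting commutes with the sum over a finite set of integers. [folklore] -/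
theorem sum_image_intCast (Z : Finset ℤ) : ∑ i ∈ Z.image (Int.cast : ℤ → ℝ), i = ((∑ i ∈ Z, i : ℤ) : ℝ) := by
  rw [Finset.sum_image fun a _ b _ h => Int.cast_injective h, Int.cast_sum]

/-- Transfer (2024 Lemma 3.1): an admissible integer set `G` is an `𝕊`-generating set of `(Hℤ)_{[-a,a]}` in
the sense of `SGenerates (HZball a) a`. [cite: ConnesConsani2024RiemannRochZ, Lemma 3.1 p. 4] -/
theorem sGenerates_of_sAdm {G : Finset ℤ} {a : ℕ} (h : SAdm G a) :
    SGenerates (HZball a) a (G.image (Int.cast : ℤ → ℝ)) := by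
  classical
  obtain ⟨hG, hgen⟩ := h
  refine ⟨?_, ?_⟩
  · intro y hy
    obtain ⟨g, hg, rfl⟩ := Finset.mem_image.mp (Finset.mem_coe.mp hy)
    refine ⟨⟨g, rfl⟩, ?_⟩
    have := hG g hg
    rw [← Int.cast_abs]; exact_mod_cast this
  · rintro x ⟨⟨m, rfl⟩, hm⟩
    have hm' : |m| ≤ (a : ℤ) := by rw [← Int.cast_abs] at hm; exact_mod_cast hm
    have hmI : m ∈ Finset.Icc (-(a : ℤ)) a := by rw [Finset.mem_Icc]; exact abs_le.mp hm'
    obtain ⟨Z, hZ, hsum, hadm⟩ := hgen m hmI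
    refine ⟨Z.image (Int.cast : ℤ → ℝ), Finset.image_subset_image (Finset.mem_powerset.mp hZ), ?_, ?_⟩
    · rw [sum_image_intCast, hsum]
    · intro Z' hZ'
      obtain ⟨W, hW, rfl⟩ := Finset.subset_image_iff.mp hZ'
      rw [sum_image_intCast, ← Int.cast_abs]
      exact_mod_cast hadm W (Finset.mem_powerset.mpr hW)

/-! ## Lower bound (2024 Lemma 3.1: `#G ≥ log₂(2a+1)`) -/

/-- Lower bound of Lemma 3.1: "the number of elements of `I_m` is `2m+1` and the number of subsets of `G` is
`2^{#G}`", so `2a + 1 ≤ 2^{#G}` for a generating set. [cite: ConnesConsani2024RiemannRochZ, Lemma 3.1 p. 4] -/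
theorem two_mul_add_one_le_two_pow_card {a : ℕ} {G : Finset ℝ} (h : SGenerates (HZball a) a G) :
    2 * a + 1 ≤ 2 ^ G.card := by
  classical
  let T : Finset ℝ := G.powerset.image fun Z => ∑ i ∈ Z, i
  have hT : T.card ≤ 2 ^ G.card := by
    have := Finset.card_image_le (s := G.powerset) (f := fun Z => ∑ i ∈ Z, i)
    rwa [Finset.card_powerset] at this
  -- the `2a+1` integers of `[-a, a]` are subset sums
  let I : Finset ℝ := (Finset.Icc (-(a : ℤ)) a).image (Int.cast : ℤ → ℝ)
  have hI : I.card = 2 * a + 1 := by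
    rw [Finset.card_image_of_injective _ Int.cast_injective, Int.card_Icc]
    omega
  have hsub : I ⊆ T := by
    intro x hx
    obtain ⟨m, hm, rfl⟩ := Finset.mem_image.mp hx
    rw [Finset.mem_Icc] at hm
    have hmem : ((m : ℤ) : ℝ) ∈ HZball a := by
      refine ⟨⟨m, rfl⟩, ?_⟩
      rw [← Int.cast_abs]; exact_mod_cast abs_le.mpr hm
    obtain ⟨Z, hZ, hsum, -⟩ := h.2 _ hmem
    exact Finset.mem_image.mpr ⟨Z, Finset.mem_powerset.mpr hZ, hsum⟩
  calc 2 * a + 1 = I.card := hI.symm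
    _ ≤ T.card := Finset.card_le_card hsub
    _ ≤ 2 ^ G.card := hT

/-! ## Small values `1 ≤ a ≤ 15` (the table on p. 4) -/

/-- The generating sets of 2024 §3 p. 4 for `1 ≤ a ≤ 15` (`{-1,1}, {-2,1,2}, {-3,1,2}, {-3,-1,1,3},
{-4,-1,2,3}, {-6,1,2,3}, {-7,1,2,4}, {-7,-1,1,2,5}, {-8,-1,1,3,5}, {-10,1,2,3,4}, …, {-15,1,2,4,8}`), each with
`k + 2` elements where `2^k ≤ a < 2^{k+1}`, verified admissible by `decide`. [cite: ConnesConsani2024RiemannRochZ, Lemma 3.2 p. 4] -/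
theorem sAdm_table (a : ℕ) (ha1 : 1 ≤ a) (ha2 : a ≤ 15) :
    ∃ k : ℕ, ∃ G : Finset ℤ, G.card = k + 2 ∧ 2 ^ k ≤ a ∧ a < 2 ^ (k + 1) ∧ SAdm G a := by
  interval_cases a
  · exact ⟨0, {-1, 1}, by decide, by norm_num, by norm_num, by decide⟩
  · exact ⟨1, {-2, 1, 2}, by decide, by norm_num, by norm_num, by decide⟩
  · exact ⟨1, {-3, 1, 2}, by decide, by norm_num, by norm_num, by decide⟩
  · exact ⟨2, {-3, -1, 1, 3}, by decide, by norm_num, by norm_num, by decide⟩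
  · exact ⟨2, {-4, -1, 2, 3}, by decide, by norm_num, by norm_num, by decide⟩
  · exact ⟨2, {-6, 1, 2, 3}, by decide, by norm_num, by norm_num, by decide⟩
  · exact ⟨2, {-7, 1, 2, 4}, by decide, by norm_num, by norm_num, by decide⟩
  · exact ⟨3, {-7, -1, 1, 2, 5}, by decide, by norm_num, by norm_num, by decide⟩
  · exact ⟨3, {-8, -1, 1, 3, 5}, by decide, by norm_num, by norm_num, by decide⟩
  · exact ⟨3, {-10, 1, 2, 3, 4}, by decide, by norm_num, by norm_num, by decide⟩
  · exact ⟨3, {-11, 1, 2, 3, 5}, by decide, by norm_num, by norm_num, by decide⟩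
  · exact ⟨3, {-12, 1, 2, 3, 6}, by decide, by norm_num, by norm_num, by decide⟩
  · exact ⟨3, {-13, 1, 2, 3, 7}, by decide, by norm_num, by norm_num, by decide⟩
  · exact ⟨3, {-14, 1, 2, 4, 7}, by decide, by norm_num, by norm_num, by decide⟩
  · exact ⟨3, {-15, 1, 2, 4, 8}, by decide, by norm_num, by norm_num, by decide⟩

/-! ## Subset sums of positive integers (2024 Lemma 3.2 (i)) -/

/-- The subset sums of a finite set `P` of naturals cover `[0, ΣP]` (the property of the `α_j` in
Lemma 3.2 (i): "any element `z ∈ [0,a]` can be written as a partial sum `z = Σ_Z α_j`"). [cite: ConnesConsani2024RiemannRochZ, Lemma 3.2 p. 4] -/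
def SubsetSumsCover (P : Finset ℕ) : Prop :=
  ∀ z, z ≤ ∑ p ∈ P, p → ∃ Z ⊆ P, ∑ p ∈ Z, p = z

/-- The empty set covers `[0, 0]`. [folklore] -/
theorem subsetSumsCover_empty : SubsetSumsCover ∅ := by
  intro z hz
  refine ⟨∅, Finset.Subset.refl _, ?_⟩
  simp only [Finset.sum_empty] at hz ⊢; omega

/-- Interval trick of the proof of Lemma 3.2 (i): adjoining `w ≤ ΣP + 1` to a covering set gives a covering
set (`J ∪ (J + w)` is again an interval). [cite: ConnesConsani2024RiemannRochZ, Lemma 3.2 p. 4] -/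
theorem subsetSumsCover_insert {P : Finset ℕ} {w : ℕ} (h : SubsetSumsCover P) (hw : w ∉ P)
    (hle : w ≤ ∑ p ∈ P, p + 1) : SubsetSumsCover (insert w P) := by
  classical
  intro z hz
  rw [Finset.sum_insert hw] at hz
  by_cases hzP : z ≤ ∑ p ∈ P, p
  · obtain ⟨Z, hZ, hs⟩ := h z hzP
    exact ⟨Z, hZ.trans (Finset.subset_insert _ _), hs⟩
  · obtain ⟨Z, hZ, hs⟩ := h (z - w) (by omega)
    have hwZ : w ∉ Z := fun hm => hw (hZ hm)
    refine ⟨insert w Z, Finset.insert_subset_insert _ hZ, ?_⟩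
    rw [Finset.sum_insert hwZ, hs]
    omega

/-- `P2 k = {2^j : 0 ≤ j < k}` — the set `T` of the proof of Lemma 3.2 (i) (with `k = n - 1`). [cite: ConnesConsani2024RiemannRochZ, Lemma 3.2 p. 4] -/
def P2 (k : ℕ) : Finset ℕ := (Finset.range k).image fun i => 2 ^ i

/-- `j ↦ 2^j` is injective. [folklore] -/
theorem two_pow_injective : Function.Injective (fun i : ℕ => 2 ^ i) :=
  fun _ _ h => Nat.pow_right_injective (le_refl 2) h

/-- `#P2 k = k`. [folklore] -/
theorem card_P2 (k : ℕ) : (P2 k).card = k := by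
  rw [P2, Finset.card_image_of_injective _ two_pow_injective, Finset.card_range]

/-- Membership in `P2 k`. [folklore] -/
theorem mem_P2 {k j : ℕ} : j ∈ P2 k ↔ ∃ i < k, 2 ^ i = j := by
  simp [P2]

/-- `2^k ∉ P2 k`. [folklore] -/
theorem pow_not_mem_P2 (k : ℕ) : 2 ^ k ∉ P2 k := by
  intro h
  obtain ⟨i, hi, he⟩ := mem_P2.mp h
  exact absurd (two_pow_injective he) (by omega)

/-- `P2 (k+1) = P2 k ∪ {2^k}`. [folklore] -/
theorem P2_succ (k : ℕ) : P2 (k + 1) = insert (2 ^ k) (P2 k) := by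
  rw [P2, Finset.range_add_one, Finset.image_insert]; rfl

/-- `Σ P2 k = 2^k - 1` ("`σ := Σ_0^{n-2} 2^j = 2^{n-1} - 1`"). [cite: ConnesConsani2024RiemannRochZ, Lemma 3.2 p. 4] -/
theorem sum_P2 (k : ℕ) : ∑ p ∈ P2 k, p + 1 = 2 ^ k := by
  induction k with
  | zero => simp [P2]
  | succ k ih =>
    rw [P2_succ, Finset.sum_insert (pow_not_mem_P2 k), pow_succ]
    omega

/-- Binary expansion: the subset sums of `{1, 2, …, 2^{k-1}}` cover `[0, 2^k - 1]`. [cite: ConnesConsani2024RiemannRochZ, Lemma 3.2 p. 4] -/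
theorem subsetSumsCover_P2 (k : ℕ) : SubsetSumsCover (P2 k) := by
  induction k with
  | zero => simpa [P2] using subsetSumsCover_empty
  | succ k ih =>
    rw [P2_succ]
    exact subsetSumsCover_insert ih (pow_not_mem_P2 k) (sum_P2 k).symm.le

/-- Elements of `P2 k` are `≥ 1`. [folklore] -/
theorem one_le_of_mem_P2 {k j : ℕ} (h : j ∈ P2 k) : 1 ≤ j := by
  obtain ⟨i, -, rfl⟩ := mem_P2.mp h
  exact Nat.one_le_two_pow

/-- An odd power of two is `1`. [folklore] -/
theorem eq_one_of_mem_P2_odd {k j : ℕ} (h : j ∈ P2 k) (hodd : j % 2 = 1) : j = 1 := by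
  obtain ⟨i, -, rfl⟩ := mem_P2.mp h
  cases i with
  | zero => rfl
  | succ i => rw [pow_succ] at hodd; omega

/-- A power of two `≡ 2 (mod 4)` is `2`. [folklore] -/
theorem eq_two_of_mem_P2 {k j : ℕ} (h : j ∈ P2 k) (hmod : j % 4 = 2) : j = 2 := by
  obtain ⟨i, -, rfl⟩ := mem_P2.mp h
  match i with
  | 0 => simp at hmod
  | 1 => rfl
  | i + 2 => rw [pow_add] at hmod; omega

/-- Lemma 3.2 (i), case 3 (`a ≠ 2^{n-1}`, `a - σ ∉ T`): `F = T ∪ {a - σ}`, `#F = n`, `ΣF = a`, covering.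
(Here `k = n - 1`, `2^k ≤ a < 2^{k+1}`.) [cite: ConnesConsani2024RiemannRochZ, Lemma 3.2 p. 4] -/
theorem cover_case3 {k a : ℕ} (h1 : 2 ^ k ≤ a) (h2 : a < 2 ^ (k + 1))
    (hT : a - (2 ^ k - 1) ∉ P2 k) :
    ∃ P : Finset ℕ, (∀ p ∈ P, 1 ≤ p) ∧ ∑ p ∈ P, p = a ∧ SubsetSumsCover P ∧ P.card = k + 1 := by
  classical
  have hs := sum_P2 k
  refine ⟨insert (a - (2 ^ k - 1)) (P2 k), ?_, ?_, ?_, ?_⟩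
  · intro p hp
    rcases Finset.mem_insert.mp hp with rfl | hp
    · omega
    · exact one_le_of_mem_P2 hp
  · rw [Finset.sum_insert hT]; rw [pow_succ] at h2; omega
  · refine subsetSumsCover_insert (subsetSumsCover_P2 k) hT ?_
    rw [pow_succ] at h2; omega
  · rw [Finset.card_insert_of_notMem hT, card_P2]

/-- Lemma 3.2 (i), case 1 (`a = 2^{n-1}`, `n > 4`): `F = {2^j : j ≤ n-3} ∪ {2^{n-2} - 2} ∪ {3}`.
(Here `l = n - 2 ≥ 3`.) [cite: ConnesConsani2024RiemannRochZ, Lemma 3.2 p. 4] -/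
theorem cover_case1 {l : ℕ} (hl : 3 ≤ l) :
    ∃ P : Finset ℕ, (∀ p ∈ P, 1 ≤ p) ∧ ∑ p ∈ P, p = 2 ^ (l + 1) ∧ SubsetSumsCover P ∧
      P.card = l + 2 := by
  classical
  have hs := sum_P2 l
  have h8 : 8 ≤ 2 ^ l := by
    calc 8 = 2 ^ 3 := by norm_num
      _ ≤ 2 ^ l := Nat.pow_le_pow_right (by norm_num) hl
  have h4 : 2 ^ l % 4 = 0 := by
    obtain ⟨t, rfl⟩ : ∃ t, l = t + 2 := ⟨l - 2, by omega⟩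
    rw [pow_add]; omega
  -- `2^l - 2 ∉ P2 l`
  have hw1 : 2 ^ l - 2 ∉ P2 l := by
    intro h
    have := eq_two_of_mem_P2 h (by omega)
    omega
  -- `3 ∉ insert (2^l - 2) (P2 l)`
  have hw2 : 3 ∉ insert (2 ^ l - 2) (P2 l) := by
    intro h
    rcases Finset.mem_insert.mp h with h | h
    · omega
    · have := eq_one_of_mem_P2_odd h (by norm_num); omega
  refine ⟨insert 3 (insert (2 ^ l - 2) (P2 l)), ?_, ?_, ?_, ?_⟩
  · intro p hp
    rcases Finset.mem_insert.mp hp with rfl | hp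
    · norm_num
    rcases Finset.mem_insert.mp hp with rfl | hp
    · omega
    · exact one_le_of_mem_P2 hp
  · rw [Finset.sum_insert hw2, Finset.sum_insert hw1, pow_succ]; omega
  · refine subsetSumsCover_insert (subsetSumsCover_insert (subsetSumsCover_P2 l) hw1 (by omega)) hw2 ?_
    rw [Finset.sum_insert hw1]; omega
  · rw [Finset.card_insert_of_notMem hw2, Finset.card_insert_of_notMem hw1, card_P2]

/-- Lemma 3.2 (i), case 2 (`a ≠ 2^{n-1}`, `a - σ = 2^j ∈ T`, so `1 ≤ j`):
`F = {2^i : i ≤ n-3} ∪ {2^{n-2} - 1} ∪ {a - σ + 1}`. (Here `l = n - 2 ≥ 3`, `a = 2^{l+1} - 1 + 2^j`.) [cite: ConnesConsani2024RiemannRochZ, Lemma 3.2 p. 4] -/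
theorem cover_case2 {l j : ℕ} (hl : 3 ≤ l) (hj1 : 1 ≤ j) (hj2 : j ≤ l) :
    ∃ P : Finset ℕ, (∀ p ∈ P, 1 ≤ p) ∧ ∑ p ∈ P, p = 2 ^ (l + 1) - 1 + 2 ^ j ∧ SubsetSumsCover P ∧
      P.card = l + 2 := by
  classical
  have hs := sum_P2 l
  have h8 : 8 ≤ 2 ^ l := by
    calc 8 = 2 ^ 3 := by norm_num
      _ ≤ 2 ^ l := Nat.pow_le_pow_right (by norm_num) hl
  have hjl : 2 ^ j ≤ 2 ^ l := Nat.pow_le_pow_right (by norm_num) hj2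
  have hj2' : 2 ≤ 2 ^ j := by
    calc 2 = 2 ^ 1 := by norm_num
      _ ≤ 2 ^ j := Nat.pow_le_pow_right (by norm_num) hj1
  have hjodd : (2 ^ j + 1) % 2 = 1 := by
    obtain ⟨t, rfl⟩ : ∃ t, j = t + 1 := ⟨j - 1, by omega⟩
    rw [pow_succ]; omega
  have hlodd : (2 ^ l - 1) % 2 = 1 := by
    obtain ⟨t, rfl⟩ : ∃ t, l = t + 1 := ⟨l - 1, by omega⟩
    rw [pow_succ]; omega
  -- `2^l - 1 ∉ P2 l`
  have hw1 : 2 ^ l - 1 ∉ P2 l := by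
    intro h
    have := eq_one_of_mem_P2_odd h hlodd
    omega
  -- `2^j + 1 ∉ insert (2^l - 1) (P2 l)`
  have hw2 : 2 ^ j + 1 ∉ insert (2 ^ l - 1) (P2 l) := by
    intro h
    rcases Finset.mem_insert.mp h with h | h
    · -- `2^j + 2 = 2^l`: then `j < l`, `2 · 2^j ≤ 2^l = 2^j + 2`, so `2^j = 2`, `2^l = 4`
      rcases hj2.eq_or_lt with rfl | hlt
      · omega
      · have : 2 ^ (j + 1) ≤ 2 ^ l := Nat.pow_le_pow_right (by norm_num) hlt
        rw [pow_succ] at this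
        omega
    · have := eq_one_of_mem_P2_odd h hjodd; omega
  refine ⟨insert (2 ^ j + 1) (insert (2 ^ l - 1) (P2 l)), ?_, ?_, ?_, ?_⟩
  · intro p hp
    rcases Finset.mem_insert.mp hp with rfl | hp
    · omega
    rcases Finset.mem_insert.mp hp with rfl | hp
    · omega
    · exact one_le_of_mem_P2 hp
  · rw [Finset.sum_insert hw2, Finset.sum_insert hw1, pow_succ]; omega
  · refine subsetSumsCover_insert (subsetSumsCover_insert (subsetSumsCover_P2 l) hw1 (by omega)) hw2 ?_
    rw [Finset.sum_insert hw1]; omega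
  · rw [Finset.card_insert_of_notMem hw2, Finset.card_insert_of_notMem hw1, card_P2]

/-- **Lemma 3.2 (i)** (`n > 4`, i.e. `a ≥ 16`): there are `n = log₂ a + 1` distinct positive integers with sum
`a` whose subset sums cover `[0, a]`. [cite: ConnesConsani2024RiemannRochZ, Lemma 3.2 p. 4] -/
theorem exists_cover_nat {a : ℕ} (ha : 16 ≤ a) :
    ∃ P : Finset ℕ, (∀ p ∈ P, 1 ≤ p) ∧ ∑ p ∈ P, p = a ∧ SubsetSumsCover P ∧
      P.card = Nat.log 2 a + 1 := by
  have h1 : 2 ^ Nat.log 2 a ≤ a := Nat.pow_log_le_self 2 (by omega)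
  have h2 : a < 2 ^ (Nat.log 2 a + 1) := Nat.lt_pow_succ_log_self (by norm_num) a
  have hk4 : 4 ≤ Nat.log 2 a := by
    by_contra h
    have : 2 ^ (Nat.log 2 a + 1) ≤ 2 ^ 4 := Nat.pow_le_pow_right (by norm_num) (by omega)
    omega
  obtain ⟨l, hl1⟩ : ∃ l, Nat.log 2 a = l + 1 := ⟨Nat.log 2 a - 1, by omega⟩
  rw [hl1] at h1 h2 hk4 ⊢
  have hl : 3 ≤ l := by omega
  by_cases ha1 : a = 2 ^ (l + 1)
  · obtain ⟨P, hp, hs, hc, hcard⟩ := cover_case1 hl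
    exact ⟨P, hp, by rw [hs, ha1], hc, by rw [hcard]⟩
  by_cases ha2 : a - (2 ^ (l + 1) - 1) ∈ P2 (l + 1)
  · obtain ⟨j, hj, hje⟩ := mem_P2.mp ha2
    have hj1 : 1 ≤ j := by
      rcases Nat.eq_zero_or_pos j with rfl | h
      · simp at hje; omega
      · exact h
    obtain ⟨P, hp, hs, hc, hcard⟩ := cover_case2 hl hj1 (by omega)
    refine ⟨P, hp, ?_, hc, by rw [hcard]⟩
    rw [hs]; omega
  · exact cover_case3 h1 h2 ha2

/-! ## Transfer: `{-a} ∪ P` is admissible -/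

/-- Casting `ℕ → ℤ` commutes with the sum over a finite set. [folklore] -/
theorem sum_image_natCast (Z : Finset ℕ) : ∑ i ∈ Z.image (Nat.cast : ℕ → ℤ), i = ((∑ i ∈ Z, i : ℕ) : ℤ) := by
  rw [Finset.sum_image fun a _ b _ h => Nat.cast_injective h, Nat.cast_sum]

/-- From Lemma 3.2 (i) to generation: if the `α_j > 0` have sum `a` and subset sums covering `[0,a]`, then
`{-a} ∪ {α_j}` is an admissible generating set of `(Hℤ)_{[-a,a]}` ("these sets are of the same type as those
constructed for `n > 4`": negative `x` are `-a +` a partial sum, and all partial sums stay in `[-a, a]`). [cite: ConnesConsani2024RiemannRochZ, Lemma 3.2 p. 4] -/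
theorem sAdm_of_cover {a : ℕ} {P : Finset ℕ} (hsum : ∑ p ∈ P, p = a) (hcov : SubsetSumsCover P) :
    SAdm (insert (-(a : ℤ)) (P.image (Nat.cast : ℕ → ℤ))) a := by
  classical
  have hle : ∀ p ∈ P, p ≤ a := fun p hp => by
    rw [← hsum]; exact Finset.single_le_sum (f := fun p => p) (fun _ _ => Nat.zero_le _) hp
  -- partial sums of a subset `W ⊆ Z ⊆ P` are between `0` and `ΣZ`
  have hpart : ∀ {Z W : Finset ℕ}, W ⊆ Z → ∑ p ∈ W, p ≤ ∑ p ∈ Z, p := fun hW =>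
    Finset.sum_le_sum_of_subset_of_nonneg hW fun _ _ _ => Nat.zero_le _
  refine ⟨?_, ?_⟩
  · intro g hg
    rcases Finset.mem_insert.mp hg with rfl | hg
    · simp
    · obtain ⟨p, hp, rfl⟩ := Finset.mem_image.mp hg
      rw [Nat.abs_cast]; exact_mod_cast hle p hp
  · intro x hx
    rw [Finset.mem_Icc] at hx
    by_cases hx0 : 0 ≤ x
    · -- `x ≥ 0`: a subset of `P`
      obtain ⟨Z, hZ, hs⟩ := hcov x.toNat (by omega)
      refine ⟨Z.image (Nat.cast : ℕ → ℤ), ?_, ?_, ?_⟩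
      · exact Finset.mem_powerset.mpr
          ((Finset.image_subset_image hZ).trans (Finset.subset_insert _ _))
      · rw [sum_image_natCast, hs]; omega
      · intro Z' hZ'
        obtain ⟨W, hW, rfl⟩ := Finset.subset_image_iff.mp (Finset.mem_powerset.mp hZ')
        rw [sum_image_natCast, Nat.abs_cast]
        have := hpart hW
        have : (∑ p ∈ W, p : ℕ) ≤ a := by omega
        exact_mod_cast this
    · -- `x < 0`: `{-a} ∪` a subset of `P` with sum `x + a`
      obtain ⟨Z, hZ, hs⟩ := hcov (x + a).toNat (by omega)
      have hnot : (-(a : ℤ)) ∉ Z.image (Nat.cast : ℕ → ℤ) := by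
        intro h
        obtain ⟨p, -, hp⟩ := Finset.mem_image.mp h
        omega
      refine ⟨insert (-(a : ℤ)) (Z.image (Nat.cast : ℕ → ℤ)), ?_, ?_, ?_⟩
      · exact Finset.mem_powerset.mpr (Finset.insert_subset_insert _ (Finset.image_subset_image hZ))
      · rw [Finset.sum_insert hnot, sum_image_natCast, hs]; omega
      · intro Z' hZ'
        have hZ'sub := Finset.mem_powerset.mp hZ'
        by_cases hmem : (-(a : ℤ)) ∈ Z'
        · have hrest : Z'.erase (-(a : ℤ)) ⊆ Z.image (Nat.cast : ℕ → ℤ) :=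
            Finset.subset_insert_iff.mp hZ'sub
          obtain ⟨W, hW, hWe⟩ := Finset.subset_image_iff.mp hrest
          rw [← Finset.add_sum_erase Z' (fun i => i) hmem, ← hWe, sum_image_natCast]
          have h1 := hpart hW
          rw [hs] at h1
          rw [abs_le]; constructor <;> omega
        · have hrest : Z' ⊆ Z.image (Nat.cast : ℕ → ℤ) := by
            have := Finset.subset_insert_iff.mp hZ'sub
            rwa [Finset.erase_eq_of_notMem hmem] at this
          obtain ⟨W, hW, rfl⟩ := Finset.subset_image_iff.mp hrest
          rw [sum_image_natCast, Nat.abs_cast]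
          have h1 := hpart hW
          rw [hs] at h1
          have : (∑ p ∈ W, p : ℕ) ≤ a := by omega
          exact_mod_cast this

/-! ## Assembly: `dim_𝕊 (Hℤ)_{[-a,a]}` -/

/-- For every `a ≥ 1` an admissible generating set of `(Hℤ)_{[-a,a]}` with `log₂ a + 2 = n + 1` elements
(table for `a ≤ 15`, Lemma 3.2 (i) for `a ≥ 16`). [cite: ConnesConsani2024RiemannRochZ, Lemma 3.2 p. 4] -/
theorem exists_sAdm (a : ℕ) (ha : 1 ≤ a) :
    ∃ G : Finset ℤ, G.card = Nat.log 2 a + 2 ∧ SAdm G a := by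
  classical
  by_cases h15 : a ≤ 15
  · obtain ⟨k, G, hcard, h1, h2, hG⟩ := sAdm_table a ha h15
    refine ⟨G, ?_, hG⟩
    rw [hcard, Nat.log_eq_of_pow_le_of_lt_pow h1 h2]
  · obtain ⟨P, hpos, hsum, hcov, hcard⟩ := exists_cover_nat (a := a) (by omega)
    refine ⟨insert (-(a : ℤ)) (P.image (Nat.cast : ℕ → ℤ)), ?_, sAdm_of_cover hsum hcov⟩
    have hnot : (-(a : ℤ)) ∉ P.image (Nat.cast : ℕ → ℤ) := by
      intro h
      obtain ⟨p, -, hp⟩ := Finset.mem_image.mp h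
      omega
    rw [Finset.card_insert_of_notMem hnot, Finset.card_image_of_injective _ Nat.cast_injective, hcard]

/-- **Lemma 3.2 (ii) / Theorem 3.3 of Connes–Consani 2024 (combinatorial core), PROVED**:
`dim_𝕊 (Hℤ)_{[-a,a]} = n + 1 = log₂ a + 2` where `2^{n-1} ≤ a < 2^n`, for every `a ≥ 1`. [cite: ConnesConsani2024RiemannRochZ, Thm. 3.3 p. 4] -/
theorem sDim_HZ_eq {a : ℕ} (ha : 1 ≤ a) : sDim (HZball a) a = Nat.log 2 a + 2 := by
  obtain ⟨G, hcard, hG⟩ := exists_sAdm a ha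
  have hgen := sGenerates_of_sAdm hG
  apply le_antisymm
  · calc sDim (HZball a) a ≤ (G.image (Int.cast : ℤ → ℝ)).card := sDim_le_card hgen
      _ = Nat.log 2 a + 2 := by rw [card_image_intCast, hcard]
  · refine le_sDim ⟨_, hgen⟩ fun G' hG' => ?_
    have h1 := two_mul_add_one_le_two_pow_card hG'
    have h2 : 2 ^ Nat.log 2 a ≤ a := Nat.pow_log_le_self 2 (by omega)
    have h3 : 2 ^ (Nat.log 2 a + 1) < 2 ^ G'.card := by rw [pow_succ]; omega
    have := (Nat.pow_lt_pow_iff_right (by norm_num)).mp h3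
    omega

/-- `dim_𝕊 (Hℤ)_{[0,0]} = 0` (the empty set generates `{0}`). [cite: ConnesConsani2024RiemannRochZ, Def. 2.1 p. 3] -/
theorem sDim_HZ_zero : sDim (HZball 0) 0 = 0 := by
  have hgen : SGenerates (HZball 0) 0 ∅ := by
    refine ⟨by simp, ?_⟩
    rintro x ⟨⟨m, rfl⟩, hm⟩
    have hm0 : (m : ℝ) = 0 := by
      have : |(m : ℝ)| ≤ 0 := by exact_mod_cast hm
      exact abs_nonpos_iff.mp this
    refine ⟨∅, Finset.Subset.refl _, by simp [hm0], ?_⟩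
    intro Z' hZ'
    rw [Finset.subset_empty.mp hZ']; simp
  exact Nat.le_zero.mp (by simpa using sDim_le_card hgen)

end Literature.NumberTheory.ConnesConsani2023

end
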